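import Literature.AnabelianGeometry.SemiGraphs.TemperedFunctorialityExactProofs
import Literature.AnabelianGeometry.SemiGraphs.TemperedCoveringsTemperedLimitsProofs
import HarnessLib

/-!
# Semi-graphs of anabelioids, §3, Proposition 3.6 (iv) — part 3: the morphism of temperoids
# `B^temp(G') → B^temp(G)` and its compatibility with the verticial homomorphisms

(Content by abc-iut-L3-t10 gen 0 — staged v2, sha256 194e2152a915 —, refiled UNCHANGED under the L3
succession rule 21:27:32Z by abc-iut-L6-d4.)

Mochizuki, *Semi-graphs of anabelioids*, Publ. RIMS **42** (2006), §3, Proposition 3.6 (iv)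
(manuscript p. 39) [cite: MochizukiSemiAnbd2006, Prop 3.6(iv) p.39]: "Any morphism of semi-graphs of
anabelioids `G' → G` induces a morphism of temperoids `B^temp(G') → B^temp(G)`" — so that, through
tempered fundamental groups (Prop. 3.6 (ii)) and Proposition 3.2, it induces a continuous [outer]
homomorphism `π₁^temp(G') → π₁^temp(G)` compatible with the verticial homomorphisms.  Continuing parts
1–2 (`covPullback`, `btempPullback`, exactness on `B^cov`), this proof-only file shows:

* `btempPullback F` preserves finite limits and countable colimits (the tempered objects are closed
  under them in `B^cov`, abc-iut-L3-d4 `TemperedCoveringsTemperedLimitsProofs`), i.e. it IS a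
  morphism of temperoids `temperoidHom F : TemperoidHom (B^temp(G')) (B^temp(G))` (Def. 3.1 (iii));
  through charts `c'`, `c` (`TemperedPiChart`): `chartTemperoidHom F c' c :
  TemperoidHom (B^temp(π₁^temp G')) (B^temp(π₁^temp G))` with pull-back functor
  `chartPullback = c⁻¹ ⋙ F^* ⋙ c'`;
* **the verticial compatibility** (first clause of the named fact `InducedHomOfMorphism`): for EVERY
  continuous `φ : π₁^temp(G') → π₁^temp(G)` with `B^temp(φ) ≅ chartPullback` and all verticial
  homomorphisms `ψ'` at `v'`, `ψ` at `F v'`, `φ ∘ ψ'` and `ψ ∘ F_{v'}` are conjugate — by the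
  definitional square `F^* ⋙ (S ↦ S_{v'}) = (S ↦ S_{F v'}) ⋙ B^temp(F_{v'})` and the Yoneda lemma on
  Galois objects (`BTemp.exists_conj_of_natTrans`, `TemperoidsResProofs.lean`);
* hence the first clause of `InducedHomOfMorphism` REDUCED to Proposition 3.2's surjectivity half
  (`TemperoidHomEqRes`, abc-iut-L3-d2; the existence of `φ`).  The second clause (locally open ⇒
  relatively temp-slim) is not treated here.

Nothing here takes a side on [IUTchIII] Cor. 3.12.
-/

noncomputable section

namespace Literature.AnabelianGeometry.SemiGraphs

namespace ProfiniteSemiGraph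

open CategoryTheory CategoryTheory.Limits

universe u

variable {𝒢' 𝒢 : ProfiniteSemiGraph.{u}}

namespace Hom

variable (F : Hom 𝒢' 𝒢)

/-! ### `F^* : B^temp(G) ⥤ B^temp(G')` is a morphism of temperoids -/

/-- `F^*` on the tempered objects preserves finite limits. [cite: MochizukiSemiAnbd2006, Prop 3.6(iv) p.39] -/
theorem preservesLimitsOfShape_btempPullback (J : Type) [SmallCategory J] [FinCategory J] :
    PreservesLimitsOfShape J F.btempPullback := by
  haveI := isTempered_isClosedUnderLimitsOfShape (𝒢 := 𝒢) J
  haveI := isTempered_isClosedUnderLimitsOfShape (𝒢 := 𝒢') J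
  haveI := CovObj.hasLimitsOfShape (𝒢 := 𝒢) (J := J)
  haveI := CovObj.hasLimitsOfShape (𝒢 := 𝒢') (J := J)
  haveI := F.preservesLimitsOfShape_covPullback J
  haveI : PreservesLimitsOfShape J (F.btempPullback ⋙ ObjectProperty.ι _) := by
    rw [F.btempPullback_comp_ι]
    infer_instance
  exact preservesLimitsOfShape_of_reflects_of_preserves F.btempPullback (ObjectProperty.ι _)

/-- `F^*` on the tempered objects preserves countable colimits. [cite: MochizukiSemiAnbd2006, Prop 3.6(iv) p.39] -/
theorem preservesColimitsOfShape_btempPullback (J : Type) [SmallCategory J] [CountableCategory J] :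
    PreservesColimitsOfShape J F.btempPullback := by
  haveI := isTempered_isClosedUnderColimitsOfShape (𝒢 := 𝒢) J
  haveI := isTempered_isClosedUnderColimitsOfShape (𝒢 := 𝒢') J
  haveI := CovObj.hasColimitsOfShape (𝒢 := 𝒢) (J := J)
  haveI := CovObj.hasColimitsOfShape (𝒢 := 𝒢') (J := J)
  haveI := F.preservesColimitsOfShape_covPullback J
  haveI : PreservesColimitsOfShape J (F.btempPullback ⋙ ObjectProperty.ι _) := by
    rw [F.btempPullback_comp_ι]
    infer_instance
  exact preservesColimitsOfShape_of_reflects_of_preserves F.btempPullback (ObjectProperty.ι _)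

/-- **[SemiAnbd] Proposition 3.6 (iv), first sentence**: the morphism of temperoids
`B^temp(G') → B^temp(G)` induced by `F : G' → G` (Definition 3.1 (iii): its pull-back functor
`F^* : B^temp(G) ⥤ B^temp(G')` preserves finite limits and countable colimits).
[cite: MochizukiSemiAnbd2006, Prop 3.6(iv) p.39] -/
def temperoidHom : TemperoidHom (BTempCat 𝒢') (BTempCat 𝒢) where
  pullback := F.btempPullback
  preservesFiniteLimits := ⟨fun J _ _ => F.preservesLimitsOfShape_btempPullback J⟩
  preservesCountableColimits J _ _ := F.preservesColimitsOfShape_btempPullback J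

/-- The pull-back functor through charts: `B^temp(π₁^temp G) ⥤ B^temp(π₁^temp G')`,
`c⁻¹ ⋙ F^* ⋙ c'`. [cite: MochizukiSemiAnbd2006, Prop 3.6(iv) p.39] -/
def chartPullback (c' : TemperedPiChart 𝒢') (c : TemperedPiChart 𝒢) : BTemp c.G ⥤ BTemp c'.G :=
  c.equiv.inverse ⋙ F.btempPullback ⋙ c'.equiv.functor

/-- The induced morphism of connected temperoids `B^temp(π₁^temp G') → B^temp(π₁^temp G)` through
charts (the input of Proposition 3.2). [cite: MochizukiSemiAnbd2006, Prop 3.6(iv) p.39] -/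
def chartTemperoidHom (c' : TemperedPiChart 𝒢') (c : TemperedPiChart 𝒢) :
    TemperoidHom (BTemp c'.G) (BTemp c.G) where
  pullback := F.chartPullback c' c
  preservesFiniteLimits := ⟨fun J _ _ => by
    haveI := F.preservesLimitsOfShape_btempPullback J
    unfold chartPullback
    infer_instance⟩
  preservesCountableColimits J _ _ := by
    haveI := F.preservesColimitsOfShape_btempPullback J
    unfold chartPullback
    infer_instance

/-! ### Compatibility with the verticial homomorphisms -/

/-- **[SemiAnbd] Proposition 3.6 (iv) / Theorem 3.7 (i), compatibility**: if `φ : π₁^temp(G') →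
π₁^temp(G)` represents the induced morphism of temperoids (`B^temp(φ) ≅ c⁻¹ ⋙ F^* ⋙ c'`), then for
all verticial homomorphisms `ψ'` of `G'` at `v'` and `ψ` of `G` at `F v'`, the homomorphisms
`φ ∘ ψ'` and `ψ ∘ F_{v'}` are conjugate in `π₁^temp(G)`. [cite: MochizukiSemiAnbd2006, Prop 3.6(iv) p.39] -/
theorem conj_of_chartPullback_iso (c' : TemperedPiChart 𝒢') (c : TemperedPiChart 𝒢)
    (φ : c'.G →ₜ* c.G) (hφ : Nonempty (F.chartPullback c' c ≅ BTemp.res φ))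
    (v' : 𝒢'.graph.Vertex) (ψ' : 𝒢'.Gv v' →ₜ* c'.G) (ψ : 𝒢.Gv (F.base.vertexMap v') →ₜ* c.G)
    (hψ' : IsVerticialHom c' v' ψ') (hψ : IsVerticialHom c (F.base.vertexMap v') ψ) :
    ∃ g : c.G, ∀ x, φ (ψ' x) = g * ψ (F.hV v' x) * g⁻¹ := by
  obtain ⟨e⟩ := hφ
  obtain ⟨e'⟩ := hψ'
  obtain ⟨eψ⟩ := hψ
  -- `B^temp(φ ∘ ψ') ≅ B^temp(ψ ∘ F_{v'})`
  let s3 : (c.equiv.inverse ⋙ F.btempPullback) ⋙ (c'.equiv.functor ⋙ BTemp.res ψ') ≅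
      (c.equiv.inverse ⋙ F.btempPullback) ⋙
        (c'.equiv.functor ⋙ (c'.equiv.inverse ⋙ ObjectProperty.ι _ ⋙ restrictV 𝒢' v')) :=
    Functor.isoWhiskerLeft _ (Functor.isoWhiskerLeft _ e'.symm)
  let s4 : (c.equiv.inverse ⋙ F.btempPullback) ⋙
        (c'.equiv.functor ⋙ (c'.equiv.inverse ⋙ ObjectProperty.ι _ ⋙ restrictV 𝒢' v')) ≅
      (c.equiv.inverse ⋙ F.btempPullback) ⋙ (ObjectProperty.ι _ ⋙ restrictV 𝒢' v') :=
    Functor.isoWhiskerLeft _ ((Functor.associator _ _ _).symm ≪≫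
      Functor.isoWhiskerRight c'.equiv.unitIso.symm _ ≪≫ Functor.leftUnitor _)
  let s5 : (c.equiv.inverse ⋙ F.btempPullback) ⋙ (ObjectProperty.ι _ ⋙ restrictV 𝒢' v') ≅
      (c.equiv.inverse ⋙ ObjectProperty.ι _ ⋙ restrictV 𝒢 (F.base.vertexMap v')) ⋙
        BTemp.res (F.hV v') :=
    Iso.refl _
  let η : BTemp.res (φ.comp ψ') ≅ BTemp.res (ψ.comp (F.hV v')) :=
    (BTemp.resComp φ ψ').symm ≪≫ Functor.isoWhiskerRight e.symm (BTemp.res ψ') ≪≫ s3 ≪≫ s4 ≪≫ s5 ≪≫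
      Functor.isoWhiskerRight eψ (BTemp.res (F.hV v')) ≪≫ BTemp.resComp ψ (F.hV v')
  obtain ⟨g, hg, -⟩ := BTemp.exists_conj_of_natTrans c.isTempered (φ.comp ψ') (ψ.comp (F.hV v')) η.hom
  refine ⟨g⁻¹, fun x => ?_⟩
  have h := hg x
  change g * φ (ψ' x) * g⁻¹ = ψ (F.hV v' x) at h
  rw [← h]
  group


/-- Edge version of the compatibility: if `φ` represents the induced morphism of temperoids, then
for all edge homomorphisms `ψ'` of `G'` at `e'` and `ψ` of `G` at `F e'` (Thm. 3.7 (iii) p. 41),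
`φ ∘ ψ'` and `ψ ∘ F_{e'}` are conjugate in `π₁^temp(G)`. [cite: MochizukiSemiAnbd2006, Prop 3.6(iv) p.39] -/
theorem conj_of_chartPullback_iso_edge (c' : TemperedPiChart 𝒢') (c : TemperedPiChart 𝒢)
    (φ : c'.G →ₜ* c.G) (hφ : Nonempty (F.chartPullback c' c ≅ BTemp.res φ))
    (e' : 𝒢'.graph.Edge) (ψ' : 𝒢'.Ge e' →ₜ* c'.G) (ψ : 𝒢.Ge (F.base.edgeMap e') →ₜ* c.G)
    (hψ' : IsEdgeHom c' e' ψ') (hψ : IsEdgeHom c (F.base.edgeMap e') ψ) :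
    ∃ g : c.G, ∀ x, φ (ψ' x) = g * ψ (F.hE e' x) * g⁻¹ := by
  obtain ⟨e⟩ := hφ
  obtain ⟨e''⟩ := hψ'
  obtain ⟨eψ⟩ := hψ
  let s3 : (c.equiv.inverse ⋙ F.btempPullback) ⋙ (c'.equiv.functor ⋙ BTemp.res ψ') ≅
      (c.equiv.inverse ⋙ F.btempPullback) ⋙
        (c'.equiv.functor ⋙ (c'.equiv.inverse ⋙ ObjectProperty.ι _ ⋙ restrictE 𝒢' e')) :=
    Functor.isoWhiskerLeft _ (Functor.isoWhiskerLeft _ e''.symm)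
  let s4 : (c.equiv.inverse ⋙ F.btempPullback) ⋙
        (c'.equiv.functor ⋙ (c'.equiv.inverse ⋙ ObjectProperty.ι _ ⋙ restrictE 𝒢' e')) ≅
      (c.equiv.inverse ⋙ F.btempPullback) ⋙ (ObjectProperty.ι _ ⋙ restrictE 𝒢' e') :=
    Functor.isoWhiskerLeft _ ((Functor.associator _ _ _).symm ≪≫
      Functor.isoWhiskerRight c'.equiv.unitIso.symm _ ≪≫ Functor.leftUnitor _)
  let s5 : (c.equiv.inverse ⋙ F.btempPullback) ⋙ (ObjectProperty.ι _ ⋙ restrictE 𝒢' e') ≅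
      (c.equiv.inverse ⋙ ObjectProperty.ι _ ⋙ restrictE 𝒢 (F.base.edgeMap e')) ⋙
        BTemp.res (F.hE e') :=
    Iso.refl _
  let η : BTemp.res (φ.comp ψ') ≅ BTemp.res (ψ.comp (F.hE e')) :=
    (BTemp.resComp φ ψ').symm ≪≫ Functor.isoWhiskerRight e.symm (BTemp.res ψ') ≪≫ s3 ≪≫ s4 ≪≫
      s5 ≪≫ Functor.isoWhiskerRight eψ (BTemp.res (F.hE e')) ≪≫ BTemp.resComp ψ (F.hE e')
  obtain ⟨g, hg, -⟩ :=
    BTemp.exists_conj_of_natTrans c.isTempered (φ.comp ψ') (ψ.comp (F.hE e')) η.hom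
  refine ⟨g⁻¹, fun x => ?_⟩
  have h := hg x
  change g * φ (ψ' x) * g⁻¹ = ψ (F.hE e' x) at h
  rw [← h]
  group

/-- **First clause of `InducedHomOfMorphism`, reduced to Proposition 3.2** (surjectivity half,
`TemperoidHomEqRes`, abc-iut-L3-d2): a continuous `φ : π₁^temp(G') → π₁^temp(G)` representing the
induced morphism of temperoids exists and is compatible, up to conjugation, with all verticial
homomorphisms. [cite: MochizukiSemiAnbd2006, Prop 3.6(iv) p.39] -/
theorem exists_inducedHom_of_eqRes (c' : TemperedPiChart 𝒢') (c : TemperedPiChart 𝒢)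
    (hEq : TemperoidHomEqRes c'.G c.G) :
    ∃ φ : c'.G →ₜ* c.G,
      ∀ (v' : 𝒢'.graph.Vertex) (ψ' : 𝒢'.Gv v' →ₜ* c'.G)
        (ψ : 𝒢.Gv (F.base.vertexMap v') →ₜ* c.G),
        IsVerticialHom c' v' ψ' → IsVerticialHom c (F.base.vertexMap v') ψ →
          ∃ g : c.G, ∀ x, φ (ψ' x) = g * ψ (F.hV v' x) * g⁻¹ := by
  haveI := c'.secondCountableTopology
  haveI := c.secondCountableTopology
  obtain ⟨φ, hφ⟩ := hEq c'.isTempered c.isTempered (F.chartTemperoidHom c' c)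
  exact ⟨φ, fun v' ψ' ψ hψ' hψ => F.conj_of_chartPullback_iso c' c φ hφ v' ψ' ψ hψ' hψ⟩

end Hom

end ProfiniteSemiGraph

end Literature.AnabelianGeometry.SemiGraphs

end
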